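import Mathlib
import Summits.ValiantsHypothesis.ValiantsHypothesis.Theorems.RigidityForcesSymmetryRankRigidMinimalReprLaplaceFiveSeparatedCaptureLineInTwoPlanes
import Summits.ValiantsHypothesis.ValiantsHypothesis.Theorems.RigidityForcesSymmetryRankRigidMinimalReprLaplaceFiveSeparatedCaptureSpanTools
import Summits.ValiantsHypothesis.ValiantsHypothesis.Theorems.RigidityForcesSymmetryRankRigidMinimalReprLaplaceFiveSeparatedCaptureTwoEqualPlusLineTools

/-!
# ValiantsHypothesis / RigidityForcesSymmetry — crux `LaplaceOptimalFive` (stmt-ValiantsHypothesis-24813), symmetric capture: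
# ★★ **THE TWO-PENCIL BOUND THROUGH A COMMON LINE** `finrank W ≤ κ(u) + finrank prolong(U₀₁ ⊔ U₀₂) + finrank prolong(U₀₁ ⊔ U₁₂)`
# (`U₀₁ = span {u, a}`, `u ∈ U₀₂`, `a ∉ U₀₂`) — the common-line companion of ✓ `finrank_le_prolong_add_prolong_of_inf_eq_bot`

Brick 3 (part 3) of the `(2,2,2)♭` residue of the K1 lane (val-port-2 g6, 2026-08-29).  In the representation of record
`T_μ = Sym(u ⊗ s) + Sym(a ⊗ t) − G¹ − G²` (two pencils, ✓ `…SeparatedCapturePencilGenerator`) the linkage `s_x u + t_x a − G¹_x ∈ U₀₂`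
kills `t` as soon as `G¹ = 0` (`u ∈ U₀₂`, `a ∉ U₀₂`).  Projecting first to `G¹`, then (on `G¹ = 0`) to `G²`, then to `s`
(✓ `finrank_map_le_add` twice), the last kernel consists of obligations `Sym(u ⊗ s)`, which are square-free, so `s` lies in the
space `K(u)` of Lemma κ (✓ `…TwoEqualPlusLineTools`): `finrank K(u) ≤ 3`, `≤ 2` if `u` has three nonzero rows, `= 0` if `u` has a
nonzero diagonal entry.

* `symDiag_eq_bot_of_diag_ne_zero`, `finrank_symDiag_le_three`, `finrank_symDiag_le_two` — the sizes of `K(u)`.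
* ★★ `finrank_le_symDiag_add_two_prolong` — master count with an abstract bound `m` on `K(u)`.
* ★ `finrank_le_three_add_two_prolong` — `finrank W ≤ 3 + p(U₀₁⊔U₀₂) + p(U₀₁⊔U₁₂)` (`u ≠ 0`);
  ★ `finrank_le_two_prolong_of_diag_ne_zero` — `≤ p + p′` when `u` has a nonzero diagonal entry.
  For the COMMON-LINE profile (Σ = 6; census of record `cl6.py`, val-port-2 g6): with ✓ `…PencilGenerator` (p ≤ 1 leaf) and
  ✓ `…CommonLineBinary` these close every residual sample whose common line is NOT a pair monomial except the prolongation profiles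
  `(2,3,3)+` at `κ = 2`; the pair-monomial common line (`κ = 3`, true capacity 3 = the atoms) stays OPEN.

Honest framing.  A count; the common-line residue above, every profile with a span of `finrank ≥ 3` outside the landed cells,
`CaptureIneqSym` in general, K1 on `K₃ ⊔ K₂`, `LaplaceOptimalFive` (OPEN · CONTESTED 72/120), `RankRigidMinimalRepr` and `VP ≠ VNP`
are NOT proved here.  No definitions, no `sorry`.
-/

set_option linter.dupNamespace false
set_option autoImplicit false

namespace Summit.ValiantsHypothesis.ValiantsHypothesis.Theorems.RigidityForcesSymmetryRankRigidMinimalRepr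

namespace LaplaceFiveSeparatedCapture

open Finset

/-! ### Sizes of the square-freeness space `K(u)` -/

/-- `K(u) = ⊥` when `u` has a nonzero diagonal entry (✓ `ker_symDiag_eq_zero_of_diag_ne_zero`). [folklore] -/
theorem symDiag_eq_bot_of_diag_ne_zero (u : Fin 5 → Fin 5 → ℂ) (q : Fin 5) (hq : u q q ≠ 0) (S : Submodule ℂ (Fin 5 → ℂ))
    (hS : ∀ s ∈ S, ∀ p r : Fin 5, s p * u p r + s p * u p r + s r * u p p = 0) : S = ⊥ := by
  apply eq_bot_iff.mpr
  intro s hs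
  rw [Submodule.mem_bot]
  exact ker_symDiag_eq_zero_of_diag_ne_zero u q hq s (hS s hs)

/-- `finrank K(u) ≤ 3` for `u ≠ 0` symmetric: `K(u)` is supported on the zero rows of `u` (at most three), or `u` has a nonzero
diagonal entry and `K(u) = ⊥`. [folklore] -/
theorem finrank_symDiag_le_three (u : Fin 5 → Fin 5 → ℂ) (hu : ∀ p q, u p q = u q p) (hu0 : u ≠ 0)
    (S : Submodule ℂ (Fin 5 → ℂ)) (hS : ∀ s ∈ S, ∀ p r : Fin 5, s p * u p r + s p * u p r + s r * u p p = 0) :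
    Module.finrank ℂ S ≤ 3 := by
  classical
  by_cases hdiag : ∃ q, u q q ≠ 0
  · obtain ⟨q, hq⟩ := hdiag
    rw [symDiag_eq_bot_of_diag_ne_zero u q hq S hS, finrank_bot]
    exact Nat.zero_le _
  push Not at hdiag
  have hab : ∃ a b : Fin 5, a ≠ b ∧ u a b ≠ 0 := by
    by_contra hcon
    push Not at hcon
    apply hu0
    funext p q
    by_cases hpq : p = q
    · subst hpq; exact hdiag p
    · exact hcon p q hpq
  obtain ⟨a, b, hab, huab⟩ := hab
  have huba : u b a ≠ 0 := by rwa [hu b a]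
  let Z : Finset (Fin 5) := Finset.univ.filter (fun p => ∀ r, u p r = 0)
  have hZmem : ∀ p, p ∈ Z ↔ ∀ r, u p r = 0 := fun p => by simp [Z]
  have hKZ : S ≤ Submodule.span ℂ
      (↑(Z.image fun k : Fin 5 => fun j : Fin 5 => if k = j then (1 : ℂ) else 0) : Set (Fin 5 → ℂ)) := by
    intro s' hs'
    refine mem_span_indicators s' Z fun k hk => ?_
    by_contra hne
    exact hk ((hZmem k).mpr (symDiag_row_eq_zero u hdiag s' (hS s' hs') k hne))
  have haZ : a ∉ Z := fun h => huab ((hZmem a).mp h b)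
  have hbZ : b ∉ Z := fun h => huba ((hZmem b).mp h a)
  have hZsub : Z ⊆ ({a, b} : Finset (Fin 5))ᶜ := by
    intro k hk
    rw [Finset.mem_compl]
    simp only [Finset.mem_insert, Finset.mem_singleton, not_or]
    exact ⟨fun h => haZ (h ▸ hk), fun h => hbZ (h ▸ hk)⟩
  have hc2 : ({a, b} : Finset (Fin 5)).card = 2 := by
    rw [Finset.card_insert_of_notMem (by simp [hab]), Finset.card_singleton]
  have hZc : Z.card ≤ 3 := by
    have := Finset.card_le_card hZsub
    rw [Finset.card_compl, hc2, Fintype.card_fin] at this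
    omega
  exact ((Submodule.finrank_mono hKZ).trans (finrank_span_indicators_le Z)).trans hZc

/-- `finrank K(u) ≤ 2` when `u` (symmetric) has an off-diagonal entry `u a b ≠ 0` and a third nonzero row `p ∉ {a, b}`. [folklore] -/
theorem finrank_symDiag_le_two (u : Fin 5 → Fin 5 → ℂ) (hu : ∀ p q, u p q = u q p) (a b p r : Fin 5) (hab : a ≠ b)
    (hpa : p ≠ a) (hpb : p ≠ b) (huab : u a b ≠ 0) (hupr : u p r ≠ 0)
    (S : Submodule ℂ (Fin 5 → ℂ)) (hS : ∀ s ∈ S, ∀ p r : Fin 5, s p * u p r + s p * u p r + s r * u p p = 0) :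
    Module.finrank ℂ S ≤ 2 := by
  classical
  by_cases hdiag : ∃ q, u q q ≠ 0
  · obtain ⟨q, hq⟩ := hdiag
    rw [symDiag_eq_bot_of_diag_ne_zero u q hq S hS, finrank_bot]
    exact Nat.zero_le _
  push Not at hdiag
  have huba : u b a ≠ 0 := by rwa [hu b a]
  let Z : Finset (Fin 5) := Finset.univ.filter (fun p => ∀ r, u p r = 0)
  have hZmem : ∀ p, p ∈ Z ↔ ∀ r, u p r = 0 := fun p => by simp [Z]
  have hKZ : S ≤ Submodule.span ℂ
      (↑(Z.image fun k : Fin 5 => fun j : Fin 5 => if k = j then (1 : ℂ) else 0) : Set (Fin 5 → ℂ)) := by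
    intro s' hs'
    refine mem_span_indicators s' Z fun k hk => ?_
    by_contra hne
    exact hk ((hZmem k).mpr (symDiag_row_eq_zero u hdiag s' (hS s' hs') k hne))
  have haZ : a ∉ Z := fun h => huab ((hZmem a).mp h b)
  have hbZ : b ∉ Z := fun h => huba ((hZmem b).mp h a)
  have hpZ : p ∉ Z := fun h => hupr ((hZmem p).mp h r)
  have hZsub : Z ⊆ ({a, b, p} : Finset (Fin 5))ᶜ := by
    intro k hk
    rw [Finset.mem_compl]
    simp only [Finset.mem_insert, Finset.mem_singleton, not_or]
    exact ⟨fun h => haZ (h ▸ hk), fun h => hbZ (h ▸ hk), fun h => hpZ (h ▸ hk)⟩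
  have hc3 : ({a, b, p} : Finset (Fin 5)).card = 3 := by
    rw [Finset.card_insert_of_notMem (by simp [hab, hpa.symm]), Finset.card_insert_of_notMem (by simp [hpb.symm]),
      Finset.card_singleton]
  have hZc : Z.card ≤ 2 := by
    have := Finset.card_le_card hZsub
    rw [Finset.card_compl, hc3, Fintype.card_fin] at this
    omega
  exact ((Submodule.finrank_mono hKZ).trans (finrank_span_indicators_le Z)).trans hZc

/-! ### The count -/

/-- ★★ **TWO-PENCIL BOUND THROUGH A COMMON LINE (master form).**  `U₀₁ = span {u, a}` with `u, a` symmetric, `u ∈ U₀₂`, `a ∉ U₀₂`;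
`U₀₂`, `U₁₂` symmetric.  If every space `S` of vectors `s` with `Sym(u ⊗ s)` square-free has `finrank S ≤ m`, then every `W` of
symmetric zero-diagonal leaf matrices captured by `L3 U₀₁ U₀₂ U₁₂` has
`finrank W ≤ m + finrank prolong(U₀₁ ⊔ U₀₂) + finrank prolong(U₀₁ ⊔ U₁₂)`. [folklore] -/
theorem finrank_le_symDiag_add_two_prolong (u a : Fin 5 → Fin 5 → ℂ) (hu : ∀ p q, u p q = u q p) (ha : ∀ p q, a p q = a q p)
    (U02 U12 W : Submodule ℂ (Fin 5 → Fin 5 → ℂ))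
    (h02s : ∀ x ∈ U02, ∀ p q : Fin 5, x p q = x q p) (h12s : ∀ x ∈ U12, ∀ p q : Fin 5, x p q = x q p)
    (huU : u ∈ U02) (haU : a ∉ U02) (m : ℕ)
    (hm : ∀ S : Submodule ℂ (Fin 5 → ℂ), (∀ s ∈ S, ∀ p r : Fin 5, s p * u p r + s p * u p r + s r * u p p = 0) →
      Module.finrank ℂ S ≤ m)
    (hWs : ∀ μ ∈ W, ∀ s t : Fin 5, μ s t = μ t s) (hWd : ∀ μ ∈ W, ∀ s : Fin 5, μ s s = 0)
    (hWc : ∀ μ ∈ W, contractZ μ ∈ L3 (Submodule.span ℂ ({u, a} : Set (Fin 5 → Fin 5 → ℂ))) U02 U12) :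
    Module.finrank ℂ W ≤ m + Module.finrank ℂ (prolong (Submodule.span ℂ ({u, a} : Set (Fin 5 → Fin 5 → ℂ)) ⊔ U02))
      + Module.finrank ℂ (prolong (Submodule.span ℂ ({u, a} : Set (Fin 5 → Fin 5 → ℂ)) ⊔ U12)) := by
  classical
  set P : Submodule ℂ (Fin 5 → Fin 5 → ℂ) := Submodule.span ℂ ({u, a} : Set (Fin 5 → Fin 5 → ℂ)) with hPdef
  have huP : u ∈ P := Submodule.subset_span (by simp)
  have haP : a ∈ P := Submodule.subset_span (by simp)
  have hPs : ∀ x ∈ P, ∀ p q : Fin 5, x p q = x q p := by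
    intro x hx p q
    obtain ⟨c, d, rfl⟩ := Submodule.mem_span_pair.mp hx
    simp only [Pi.add_apply, Pi.smul_apply, smul_eq_mul, hu p q, ha p q]
  -- placements
  let symU : (Fin 5 → ℂ) →ₗ[ℂ] (Fin 5 → Fin 5 → Fin 5 → ℂ) :=
    { toFun := fun z p q r => z p * u q r + z q * u p r + z r * u p q
      map_add' := fun z y => by funext p q r; simp only [Pi.add_apply]; ring
      map_smul' := fun c z => by funext p q r; simp only [Pi.smul_apply, smul_eq_mul, RingHom.id_apply]; ring }
  let symA : (Fin 5 → ℂ) →ₗ[ℂ] (Fin 5 → Fin 5 → Fin 5 → ℂ) :=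
    { toFun := fun z p q r => z p * a q r + z q * a p r + z r * a p q
      map_add' := fun z y => by funext p q r; simp only [Pi.add_apply]; ring
      map_smul' := fun c z => by funext p q r; simp only [Pi.smul_apply, smul_eq_mul, RingHom.id_apply]; ring }
  let tensUA : ((Fin 5 → ℂ) × (Fin 5 → ℂ)) →ₗ[ℂ] (Fin 5 → Fin 5 → Fin 5 → ℂ) :=
    { toFun := fun z x q r => z.1 x * u q r + z.2 x * a q r
      map_add' := fun z y => by funext x q r; simp only [Prod.fst_add, Prod.snd_add, Pi.add_apply]; ring
      map_smul' := fun c z => by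
        funext x q r; simp only [Prod.smul_fst, Prod.smul_snd, Pi.smul_apply, smul_eq_mul, RingHom.id_apply]; ring }
  -- representation space `(s, t, G¹, G²)`
  let Xsp := ((Fin 5 → ℂ) × (Fin 5 → ℂ)) × ((Fin 5 → Fin 5 → Fin 5 → ℂ) × (Fin 5 → Fin 5 → Fin 5 → ℂ))
  let πst : Xsp →ₗ[ℂ] ((Fin 5 → ℂ) × (Fin 5 → ℂ)) := LinearMap.fst ℂ _ _
  let πs : Xsp →ₗ[ℂ] (Fin 5 → ℂ) := (LinearMap.fst ℂ _ _).comp πst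
  let πt : Xsp →ₗ[ℂ] (Fin 5 → ℂ) := (LinearMap.snd ℂ _ _).comp πst
  let πG1 : Xsp →ₗ[ℂ] (Fin 5 → Fin 5 → Fin 5 → ℂ) := (LinearMap.fst ℂ _ _).comp (LinearMap.snd ℂ _ _)
  let πG2 : Xsp →ₗ[ℂ] (Fin 5 → Fin 5 → Fin 5 → ℂ) := (LinearMap.snd ℂ _ _).comp (LinearMap.snd ℂ _ _)
  let Φ : Xsp →ₗ[ℂ] (Fin 5 → Fin 5 → Fin 5 → ℂ) := symU.comp πs + symA.comp πt - πG1 - πG2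
  let lamB : Xsp →ₗ[ℂ] (Fin 5 → Fin 5 → Fin 5 → ℂ) := tensUA.comp πst - πG1
  let lamC : Xsp →ₗ[ℂ] (Fin 5 → Fin 5 → Fin 5 → ℂ) := tensUA.comp πst - πG2
  have hΦ : ∀ x : Xsp, ∀ p q r, Φ x p q r = (x.1.1 p * u q r + x.1.1 q * u p r + x.1.1 r * u p q)
      + (x.1.2 p * a q r + x.1.2 q * a p r + x.1.2 r * a p q) - x.2.1 p q r - x.2.2 p q r := fun x p q r => rfl
  have hlamB : ∀ x : Xsp, ∀ y q r, lamB x y q r = x.1.1 y * u q r + x.1.2 y * a q r - x.2.1 y q r := fun x y q r => rfl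
  have hlamC : ∀ x : Xsp, ∀ y q r, lamC x y q r = x.1.1 y * u q r + x.1.2 y * a q r - x.2.2 y q r := fun x y q r => rfl
  have hπs : ∀ x : Xsp, πs x = x.1.1 := fun x => rfl
  have hπG1 : ∀ x : Xsp, πG1 x = x.2.1 := fun x => rfl
  have hπG2 : ∀ x : Xsp, πG2 x = x.2.2 := fun x => rfl
  let U02pi : Submodule ℂ (Fin 5 → Fin 5 → Fin 5 → ℂ) := Submodule.pi Set.univ (fun _ : Fin 5 => U02)
  let U12pi : Submodule ℂ (Fin 5 → Fin 5 → Fin 5 → ℂ) := Submodule.pi Set.univ (fun _ : Fin 5 => U12)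
  let R : Submodule ℂ Xsp := (W.map cZ).comap Φ ⊓ ((prolong (P ⊔ U02)).comap πG1 ⊓ ((prolong (P ⊔ U12)).comap πG2 ⊓
    (U02pi.comap lamB ⊓ U12pi.comap lamC)))
  -- every obligation lies in `Φ(R)`
  have hmem : ∀ μ ∈ W, contractZ μ ∈ R.map Φ := by
    intro μ hμ
    obtain ⟨A, B, C, hA, hB, hC, hT⟩ := L3_finite_form P U02 U12 (hWc μ hμ)
    have hAc : ∀ y, ∃ c d : ℂ, c • u + d • a = A y := fun y => Submodule.mem_span_pair.mp (hA y)
    choose s t hst using hAc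
    have hA' : ∀ y p q, A y p q = s y * u p q + t y * a p q := fun y p q => by
      rw [← hst y]; simp only [Pi.add_apply, Pi.smul_apply, smul_eq_mul]
    have hAs : ∀ y p q, A y p q = A y q p := fun y => hPs _ (hA y)
    let G1 : Fin 5 → Fin 5 → Fin 5 → ℂ := fun x y z => A x y z - B x y z
    let G2 : Fin 5 → Fin 5 → Fin 5 → ℂ := fun x y z => A x y z - C x y z
    have hG1d : ∀ x y z, G1 x y z = A x y z - B x y z := fun _ _ _ => rfl
    have hG2d : ∀ x y z, G2 x y z = A x y z - C x y z := fun _ _ _ => rfl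
    have h1_23 : ∀ x y z, G1 x y z = G1 x z y := fun x y z => by rw [hG1d, hG1d, hAs x y z, h02s _ (hB x) y z]
    have h2_23 : ∀ x y z, G2 x y z = G2 x z y := fun x y z => by rw [hG2d, hG2d, hAs x y z, h12s _ (hC x) y z]
    have h1_13 : ∀ x y z, G1 x y z = G1 z y x := fun x y z => by
      have h := contractZ_swap23 μ y x z
      rw [hT, hT] at h
      have hc := h12s _ (hC y) z x
      rw [hG1d, hG1d]
      linear_combination h - hc
    have h2_13 : ∀ x y z, G2 x y z = G2 z y x := fun x y z => by
      have h : contractZ μ z y x = contractZ μ x y z := by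
        rw [contractZ_swap12 μ y z x, contractZ_swap23 μ y x z, contractZ_swap12 μ x y z]
      rw [hT, hT, hAs x z y, hAs z x y] at h
      have hb := h02s _ (hB y) z x
      rw [hG2d, hG2d]
      linear_combination h - hb
    have h1_12 : ∀ x y z, G1 x y z = G1 y x z := fun x y z => by rw [h1_23 y x z, h1_13 y z x, h1_23 x z y]
    have h2_12 : ∀ x y z, G2 x y z = G2 y x z := fun x y z => by rw [h2_23 y x z, h2_13 y z x, h2_23 x z y]
    have hAx : ∀ x, A x = s x • u + t x • a := fun x => by
      funext p q; rw [hA']; simp only [Pi.add_apply, Pi.smul_apply, smul_eq_mul]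
    have hG1p : G1 ∈ prolong (P ⊔ U02) := by
      refine (mem_prolong_iff _ G1).mpr ⟨h1_12, h1_23, fun x => ?_⟩
      have e : G1 x = A x - B x := by funext y z; rw [hG1d, Pi.sub_apply, Pi.sub_apply]
      rw [e]
      exact Submodule.sub_mem _ (Submodule.mem_sup_left (hA x)) (Submodule.mem_sup_right (hB x))
    have hG2p : G2 ∈ prolong (P ⊔ U12) := by
      refine (mem_prolong_iff _ G2).mpr ⟨h2_12, h2_23, fun x => ?_⟩
      have e : G2 x = A x - C x := by funext y z; rw [hG2d, Pi.sub_apply, Pi.sub_apply]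
      rw [e]
      exact Submodule.sub_mem _ (Submodule.mem_sup_left (hA x)) (Submodule.mem_sup_right (hC x))
    have hrep : Φ ((s, t), (G1, G2)) = contractZ μ := by
      funext p q r
      rw [hΦ, hT p q r]
      show (s p * u q r + s q * u p r + s r * u p q) + (t p * a q r + t q * a p r + t r * a p q) - G1 p q r - G2 p q r
        = A r p q + B q p r + C p q r
      rw [h1_12 p q r, hG1d, hG2d, hA' r p q, hA' q p r, hA' p q r]
      ring
    refine Submodule.mem_map.mpr ⟨((s, t), (G1, G2)), ?_, hrep⟩
    refine Submodule.mem_inf.mpr ⟨?_, Submodule.mem_inf.mpr ⟨?_, Submodule.mem_inf.mpr ⟨?_, Submodule.mem_inf.mpr ⟨?_, ?_⟩⟩⟩⟩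
    · rw [Submodule.mem_comap, hrep]
      exact Submodule.mem_map.mpr ⟨μ, hμ, cZ_apply μ⟩
    · rw [Submodule.mem_comap]; exact hG1p
    · rw [Submodule.mem_comap]; exact hG2p
    · rw [Submodule.mem_comap, Submodule.mem_pi]
      intro y _
      have e : lamB ((s, t), (G1, G2)) y = B y := by
        funext q r
        rw [hlamB]
        show s y * u q r + t y * a q r - G1 y q r = B y q r
        rw [hG1d, hA']; ring
      rw [e]; exact hB y
    · rw [Submodule.mem_comap, Submodule.mem_pi]
      intro y _
      have e : lamC ((s, t), (G1, G2)) y = C y := by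
        funext q r
        rw [hlamC]
        show s y * u q r + t y * a q r - G2 y q r = C y q r
        rw [hG2d, hA']; ring
      rw [e]; exact hC y
  -- linkage: `G¹ = 0` forces `t = 0` (because `u ∈ U₀₂` and `a ∉ U₀₂`)
  have ht0 : ∀ x ∈ R, πG1 x = 0 → x.1.2 = 0 := by
    intro x hx hG10
    obtain ⟨-, hx2⟩ := Submodule.mem_inf.mp hx
    obtain ⟨-, hx3⟩ := Submodule.mem_inf.mp hx2
    obtain ⟨-, hx4⟩ := Submodule.mem_inf.mp hx3
    obtain ⟨hxB, -⟩ := Submodule.mem_inf.mp hx4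
    rw [Submodule.mem_comap, Submodule.mem_pi] at hxB
    rw [hπG1] at hG10
    funext y
    by_contra hty
    have hy := hxB y (Set.mem_univ y)
    have e : lamB x y = x.1.1 y • u + x.1.2 y • a := by
      funext q r
      show x.1.1 y * u q r + x.1.2 y * a q r - x.2.1 y q r = (x.1.1 y • u + x.1.2 y • a) q r
      rw [hG10]
      simp
    rw [e] at hy
    have hta : x.1.2 y • a ∈ U02 := by
      have h2 := U02.sub_mem hy (U02.smul_mem (x.1.1 y) huU)
      rwa [add_sub_cancel_left] at h2
    have : a ∈ U02 := by
      have h2 := U02.smul_mem (x.1.2 y)⁻¹ hta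
      rwa [smul_smul, inv_mul_cancel₀ hty, one_smul] at h2
    exact haU this
  -- first projection: `π = G¹`, `ρ = (s, G²)`
  let ρ1 : Xsp →ₗ[ℂ] ((Fin 5 → ℂ) × (Fin 5 → Fin 5 → Fin 5 → ℂ)) := LinearMap.prod πs πG2
  have hρ1 : ∀ x ∈ R, πG1 x = 0 → ρ1 x = 0 → x = 0 := by
    intro x hx hG10 hρ0
    have hs0 : πs x = 0 := congrArg Prod.fst hρ0
    have hG20 : πG2 x = 0 := congrArg Prod.snd hρ0
    have ht := ht0 x hx hG10
    rw [hπG1] at hG10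
    rw [hπG2] at hG20
    rw [hπs] at hs0
    exact Prod.ext (Prod.ext hs0 ht) (Prod.ext hG10 hG20)
  have hstep1 := finrank_map_le_add Φ πG1 ρ1 R hρ1
  -- second projection on `R' = R ⊓ ker G¹`: `π = G²`, `ρ = s`
  let R' : Submodule ℂ Xsp := R ⊓ LinearMap.ker πG1
  have hρ2 : ∀ x ∈ R', πG2 x = 0 → πs x = 0 → x = 0 := by
    intro x hx hG20 hs0
    obtain ⟨hxR, hxk⟩ := Submodule.mem_inf.mp hx
    have hG10 : πG1 x = 0 := LinearMap.mem_ker.mp hxk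
    have ht := ht0 x hxR hG10
    rw [hπG1] at hG10
    rw [hπG2] at hG20
    rw [hπs] at hs0
    exact Prod.ext (Prod.ext hs0 ht) (Prod.ext hG10 hG20)
  have hstep2 := finrank_map_le_add ρ1 πG2 πs R' hρ2
  -- the last kernel: `G¹ = G² = 0`, `t = 0`, the obligation is `Sym(u ⊗ s)`, square-free ⇒ `s ∈ K(u)`
  have hS : ∀ s ∈ (R' ⊓ LinearMap.ker πG2).map πs, ∀ p r : Fin 5, s p * u p r + s p * u p r + s r * u p p = 0 := by
    intro s hs p r
    obtain ⟨x, hx, rfl⟩ := Submodule.mem_map.mp hs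
    obtain ⟨hxR', hxk2⟩ := Submodule.mem_inf.mp hx
    obtain ⟨hxR, hxk1⟩ := Submodule.mem_inf.mp hxR'
    have hG10 : πG1 x = 0 := LinearMap.mem_ker.mp hxk1
    have hG20 : πG2 x = 0 := LinearMap.mem_ker.mp hxk2
    have ht := ht0 x hxR hG10
    rw [hπG1] at hG10
    rw [hπG2] at hG20
    obtain ⟨hxW, -⟩ := Submodule.mem_inf.mp hxR
    rw [Submodule.mem_comap] at hxW
    obtain ⟨μ, -, hμ⟩ := Submodule.mem_map.mp hxW
    have e := congrFun (congrFun (congrFun hμ p) p) r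
    rw [cZ_apply, contractZ_rep12, hΦ, ht, hG10, hG20] at e
    rw [hπs]
    simp only [Pi.zero_apply, zero_mul, add_zero, sub_zero] at e
    linear_combination -e
  have hm' := hm _ hS
  -- bounds of the images
  have h1 : Module.finrank ℂ (R.map πG1) ≤ Module.finrank ℂ (prolong (P ⊔ U02)) := by
    refine Submodule.finrank_mono ?_
    rw [Submodule.map_le_iff_le_comap]
    exact inf_le_right.trans inf_le_left
  have h2 : Module.finrank ℂ (R'.map πG2) ≤ Module.finrank ℂ (prolong (P ⊔ U12)) := by
    refine Submodule.finrank_mono ?_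
    rw [Submodule.map_le_iff_le_comap]
    exact inf_le_left.trans (inf_le_right.trans (inf_le_right.trans inf_le_left))
  -- `W ↪ Φ(R)`
  let f : W →ₗ[ℂ] (R.map Φ) := LinearMap.codRestrict (R.map Φ) (cZ.domRestrict W) (fun μ => by
    simpa [cZ_apply] using hmem μ.1 μ.2)
  have hf : Function.Injective f := by
    rw [injective_iff_map_eq_zero]
    intro μ hμ
    have hT : contractZ μ.1 = 0 := by
      have := congrArg Subtype.val hμ
      simpa [f, cZ_apply] using this
    apply Subtype.ext
    refine hub_injective μ.1 (hWs μ.1 μ.2) (hWd μ.1 μ.2) fun p q => ?_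
    simp [hT]
  have hW_le := LinearMap.finrank_le_finrank_of_injective hf
  have e1 : (R ⊓ LinearMap.ker πG1).map ρ1 = R'.map ρ1 := rfl
  rw [e1] at hstep1
  omega

/-- ★ **`finrank W ≤ 3 + finrank prolong(U₀₁ ⊔ U₀₂) + finrank prolong(U₀₁ ⊔ U₁₂)`** for `U₀₁ = span {u, a}`, `u ≠ 0`, `u ∈ U₀₂`,
`a ∉ U₀₂` (✓ `finrank_symDiag_le_three`). [folklore] -/
theorem finrank_le_three_add_two_prolong (u a : Fin 5 → Fin 5 → ℂ) (hu : ∀ p q, u p q = u q p) (ha : ∀ p q, a p q = a q p)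
    (hu0 : u ≠ 0) (U02 U12 W : Submodule ℂ (Fin 5 → Fin 5 → ℂ))
    (h02s : ∀ x ∈ U02, ∀ p q : Fin 5, x p q = x q p) (h12s : ∀ x ∈ U12, ∀ p q : Fin 5, x p q = x q p)
    (huU : u ∈ U02) (haU : a ∉ U02)
    (hWs : ∀ μ ∈ W, ∀ s t : Fin 5, μ s t = μ t s) (hWd : ∀ μ ∈ W, ∀ s : Fin 5, μ s s = 0)
    (hWc : ∀ μ ∈ W, contractZ μ ∈ L3 (Submodule.span ℂ ({u, a} : Set (Fin 5 → Fin 5 → ℂ))) U02 U12) :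
    Module.finrank ℂ W ≤ 3 + Module.finrank ℂ (prolong (Submodule.span ℂ ({u, a} : Set (Fin 5 → Fin 5 → ℂ)) ⊔ U02))
      + Module.finrank ℂ (prolong (Submodule.span ℂ ({u, a} : Set (Fin 5 → Fin 5 → ℂ)) ⊔ U12)) :=
  finrank_le_symDiag_add_two_prolong u a hu ha U02 U12 W h02s h12s huU haU 3
    (fun S hS => finrank_symDiag_le_three u hu hu0 S hS) hWs hWd hWc

/-- ★ **`finrank W ≤ finrank prolong(U₀₁ ⊔ U₀₂) + finrank prolong(U₀₁ ⊔ U₁₂)`** when moreover `u` has a nonzero diagonal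
entry (✓ `symDiag_eq_bot_of_diag_ne_zero`). [folklore] -/
theorem finrank_le_two_prolong_of_diag_ne_zero (u a : Fin 5 → Fin 5 → ℂ) (hu : ∀ p q, u p q = u q p) (ha : ∀ p q, a p q = a q p)
    (q : Fin 5) (hq : u q q ≠ 0) (U02 U12 W : Submodule ℂ (Fin 5 → Fin 5 → ℂ))
    (h02s : ∀ x ∈ U02, ∀ p q : Fin 5, x p q = x q p) (h12s : ∀ x ∈ U12, ∀ p q : Fin 5, x p q = x q p)
    (huU : u ∈ U02) (haU : a ∉ U02)
    (hWs : ∀ μ ∈ W, ∀ s t : Fin 5, μ s t = μ t s) (hWd : ∀ μ ∈ W, ∀ s : Fin 5, μ s s = 0)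
    (hWc : ∀ μ ∈ W, contractZ μ ∈ L3 (Submodule.span ℂ ({u, a} : Set (Fin 5 → Fin 5 → ℂ))) U02 U12) :
    Module.finrank ℂ W ≤ Module.finrank ℂ (prolong (Submodule.span ℂ ({u, a} : Set (Fin 5 → Fin 5 → ℂ)) ⊔ U02))
      + Module.finrank ℂ (prolong (Submodule.span ℂ ({u, a} : Set (Fin 5 → Fin 5 → ℂ)) ⊔ U12)) := by
  have h := finrank_le_symDiag_add_two_prolong u a hu ha U02 U12 W h02s h12s huU haU 0
    (fun S hS => by rw [symDiag_eq_bot_of_diag_ne_zero u q hq S hS, finrank_bot]) hWs hWd hWc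
  omega

end LaplaceFiveSeparatedCapture

end Summit.ValiantsHypothesis.ValiantsHypothesis.Theorems.RigidityForcesSymmetryRankRigidMinimalRepr
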